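/-
Copyright (c) 2026 the pub-hodgecm-mathlib formalisation cell (harness21).  Prover seat hodgecm-mathlib-K2Liu-p03 (g8), Track B «K2-LIT»,
#184♮ = hLiu418 = `stmt-HodgeConjecture-24832`; socket #41, KIND 1 — (K1a-T-arch) THE ARCHIMEDEAN INTEGRABILITY LETTER `hintArch` OF ★ p863805
`K2LiuKindOneSingularTailOfRecord.htail_hsplit_of_record` AT ANY INDEX (K1-a♮ line lead K2E5-p16 (g8) DESK NAME 2026-09-05T00:50:55Z; LEAD F0P6-plan (g15)
BATCH #201 default (hint-any)): ★ `K2LiuKindWArchLetterIntegrableBridge` §3∕§4's road with the KIND-W slot shape (`det ↑S ≠ 0`, carrier pinned to `U(S,h)`) REMOVED.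
THEOREMS ONLY (no `def`, no `instance`, no notation, no named-fact hypothesis, no `sorry`, default heartbeats).
-/
import Summits.HodgeConjecture.HodgeConjecture.Theorems.K2LiuKindWArchLetterIntegrableBridge   -- ★ (x-a-pres)(i) (K2Liu-p11): ENGINE `integrable_conj_unipDeltaChar_mul_of_sumPresentation` (⊇ ★ (iii-arch-int), ★ (E8rec) FILE 18∕20∕21∕22, ★ arch₄, reading frames)
import HarnessLib

/-!
# Crux `HLiu418`, socket #41, KIND 1 a♮ — (K1a-T-arch) `K2LiuKindOneArchLetterIntegrable`: `a ↦ conj ψ_{S'}(ι_∞ a) · Finf j s((w_Δ)_∞·a·h'_∞)` IS `ν`-INTEGRABLE ON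
# `N_Δ(L⁺⊗ℝ)` FOR EVERY INDEX `S'` (singular included), EVERY Haar `ν`, EVERY point, `½ < re s` — the `hintArch` letter of ★ p863805, unconditionally

Cell `hodgecm-mathlib`, crux item hLiu418 = `stmt-HodgeConjecture-24832` (helper lane `--supports … --as helper`, count-neutral), route of record `HCCMUnconditional`;
squad K2 ∕ K2Liu, road `K2_Liu`, socket #41 `sig_K2LiuSiegelEisensteinContinuation`, KIND 1, block K1-a♮.  CONSUMER: ★ p863805 `K2LiuKindOneSingularTailOfRecord.htail_hsplit_of_record`
— its by-value binder `hintArch : ∀ (S' : Matrix (Fin 2) (Fin 2) L) (h' : HA) (T : Finset) (s : ℂ) (j : Fin m), 1 < s.re → Integrable (a ↦ conj ψ_{S'}(ι_∞ a) · Finf j s ((w_Δ)_∞·a·h'_∞)) (νinf T)`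
(the K1-a♮ twin of F0P2-p08's KIND-W slot `hintArch`, WITHOUT the `det ↑S ≠ 0` guard and at an ARBITRARY carrier: the singular corner index `σ♭ E₁₁` is where K1-a♮ lives).

CENSUS (K2E5-p16 (g8)'s one-line question «does the ★ proof USE `det S ≠ 0`?»): NO.  The engine ★ (iii-arch-int) `K2LiuKindWArchLetterIntegrable.integrable_conj_unipDeltaChar_mul_of_presentation`
and ★ Bridge §1 `K2LiuKindWArchLetterIntegrableBridge.integrable_conj_unipDeltaChar_mul_of_sumPresentation` (K2Liu-p11 (g5)) are stated at ANY `S : Matrix (Fin 2) (Fin 2) L`, ANY Haar `ν`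
on `N_Δ(L⁺⊗ℝ)`, ANY right factor: the weight `conj ψ_S(ι_∞ a)` enters only as a unimodular continuous factor (`Integrable.bdd_mul`), and the majorant is ★ FILE A §5's Γ₂ ∕
Siegel–Gindikin bound on the FLAT PRODUCT over the complex places — index-free, so nothing degenerates at rank one.  ★ `hintArch_of_conjugator` ∕ ★ `hintArch_of_std` carry
`det ↑S ≠ 0` only as the KIND-W slot's binder shape (introduced, unused) and pin the carrier to `νinf (kindWFinset T₀ ↑S h)`.  THIS FILE re-runs their road with the conclusion
generalised:
* §1 **`integrable_conj_unipDeltaChar_mul_of_archLetters`** — for a standard datum `𝒦'`, a Hecke character `χ` of unitary archimedean type `(t, 0)` (`ht`), a base parameter `s₀`,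
  and ONE archimedean factor `A₁ : H_∞ → ℂ` carrying the three ★ (KW-fac) output clauses (`hAlaw` finPart-form Siegel law at `s₀`, `hfin` `K_∞`-finiteness w.r.t. `𝒦'`, `hAc`
  continuity — ★ `K2LiuKindWFactorizableDecomposition.exists_kindW_factorization` (3)): for EVERY Haar `ν` on `N_Δ(L⁺⊗ℝ)`, EVERY index `S'`, EVERY right factor `hpt ∈ H_∞` and
  `½ < re s`, `a ↦ conj ψ_{S'}(ι_∞ a) · (H_{𝒦'}((w_Δ)_∞·a·hpt)^{2(s−s₀)} · A₁((w_Δ)_∞·a·hpt))` is `ν`-integrable.  Road (= ★ Bridge §3 verbatim): tube frames of record ★ arch₄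
  `exists_tubeFrame_arch₄` (Shimura shape ★ `isUnit_det_shimuraFrame` ∕ ★ `tw_ne_zero`), reading frames ★ `exists_readingFrame` + ★ `tube_eq_of_chart_formula` + ★ `kappa_eq`,
  the conjugator ★ FILE 21 `exists_frameCompact_conjugator`, the flat tube presentation ★ FILE 18 `exists_flat_tube_presentation` (dictionary ★ `isArchSiegelDeltaSection_of_finPart_eq_one`),
  then the ENGINE ★ Bridge §1 at `(ν, S', hpt)`.
* §2 **`hintArch_of_isArchSiegelSection`** — ★ p863805's `hintArch` binder BYTES VERBATIM, from the family `A : Fin m → H_∞ → ℂ` with the (KW-fac) clauses per `j`, Haar carriers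
  `νinf T`, and the READING `hread : Finf j s a = H_{𝒦'}(a)^{2(s−s₀)} · A j a` of the place-indexed Σ⊗ letter (`rfl` at the tie on ★ (KW-fac) (3)'s `Finf`): §1 at
  `(νinf T, S', h'_∞)`, `½ < 1 < re s`, `Integrable.congr` along `hread`.
HONEST LABEL.  Count-neutral helper (no new mathematics: ★ K2Liu-p11 lineage's engine, re-addressed); it closes no socket: `HC_CM` is proved only modulo the 7 printed citations
(2 remaining named inputs: hLiu418 = `stmt-HodgeConjecture-24832`, h413 = `stmt-HodgeConjecture-24833`) until rung 0 closes.

## References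
* [Shimura1997] G. Shimura, *Euler Products and Eisenstein Series*, CBMS 93 (1997), §16.4, §18.4 (archimedean factors; absolute convergence of the intertwining integral).
* [KudlaRallis1994] S. Kudla, S. Rallis, Ann. of Math. 140 (1994), §1–§2 (Euler factorisation of the Fourier coefficients of Siegel Eisenstein series).
* [Tan1999] V. Tan, *Poles of Siegel Eisenstein series on U(n,n)*, Canad. J. Math. 51 (1999), §1 p. 166, §3 (standard sections `Φ_∞ ⊗ Φ_f`).
* [BorelJacquet1979] A. Borel, H. Jacquet, Proc. Symp. Pure Math. 33 (1979), §4.1 (archimedean components, `K_∞`-finite vectors).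
-/

set_option autoImplicit false
set_option linter.dupNamespace false -- the mandated namespace repeats `HodgeConjecture.HodgeConjecture`

noncomputable section

open scoped Matrix ComplexConjugate NNReal Classical
open Complex Matrix MeasureTheory MeasureTheory.Measure NumberField NumberField.InfinitePlace IsDedekindDomain
open Literature.NumberTheory.ModularForms.SiegelUpperHalfSpace (moeb denom)
open Literature.NumberTheory.Automorphic Literature.NumberTheory.Automorphic.UnitaryGroup Literature.NumberTheory.GaloisRepresentations
open Literature.NumberTheory.GelbartRogawski1991 Literature.NumberTheory.GelbartRogawski1991.GRConstruction
open Literature.NumberTheory.GelbartRogawski1991.UnitaryDualPair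
open Literature.NumberTheory.K2Lit.SiegelDoubled

namespace Summit.HodgeConjecture.HodgeConjecture.Cruxes.HLiu418.K2LiuKindOneArchLetterIntegrable

open K2LiuU22CompactPictureDefs K2LiuArchInducedTubeDefs K2LiuSiegelUnipotentLocalDefs K2LiuArchSWSpanningDefs
open K2LiuSiegelUnipotentFourierDefs (unipDeltaChar)
open K2LiuHermitianTubeFrameSign (exists_tubeFrame_arch₄)
open K2LiuHermitianTubeFrameArch (tw_ne_zero)
open K2LiuArchSiegelCharacterTube (isUnit_det_shimuraFrame)
open K2LiuArchReadingFrame (exists_readingFrame)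
open K2LiuArchSiegelCharacterTubeConsumer (tube_eq_of_chart_formula)
open K2LiuArchFrameBridge (kappa_eq)
open K2LiuArchFlatTubePresentation (exists_flat_tube_presentation)
open K2LiuArchFrameCompactConjugator (exists_frameCompact_conjugator)
open K2LiuKindWArchLetterIntegrableBridge (integrable_conj_unipDeltaChar_mul_of_sumPresentation)

variable (L : Type) [Field L] [NumberField L] [IsCMField L]
variable {N₀ M₀ : ℕ} (e : Fin N₀ × Fin M₀ ≃ Fin 2)
  (dV : Fin N₀ → L) (hdV : ∀ i, IsCMField.complexConj L (dV i) = dV i)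
  (dW : Fin M₀ → L) (hdW : ∀ i, IsCMField.complexConj L (dW i) = dW i)
  [MeasurableSpace ↥(unipDeltaArch L e dV hdV dW hdW)] [BorelSpace ↥(unipDeltaArch L e dV hdV dW hdW)]

/-! ## §1 One archimedean factor of a standard datum: integrable at every index, every Haar carrier, every right factor -/

/-- **§1 THE TWISTED ARCHIMEDEAN FACTOR OF A STANDARD DATUM IS `ν`-INTEGRABLE AT EVERY INDEX.**  `𝒦'` standard, `χ` of unitary archimedean type `(t, 0)` (`ht`), `s₀`, ONE archimedean
factor `A₁ : H_∞ → ℂ` with the three ★ (KW-fac) output clauses VERBATIM (`hAlaw` the finPart-form Siegel law at `s₀`, `hfin` `K_∞`-finiteness w.r.t. `𝒦'`, `hAc` continuity).  THEN for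
EVERY Haar measure `ν` on `N_Δ(L⁺⊗ℝ)`, EVERY index `S' ∈ M₂(L)` (singular allowed), EVERY right factor `hpt ∈ H_∞` and `½ < re s`:
`Integrable (a ↦ conj ψ_{S'}(ι_∞ a) · (H_{𝒦'}((w_Δ)_∞·a·hpt)^{2(s−s₀)} · A₁((w_Δ)_∞·a·hpt))) ν`.  Road = ★ `K2LiuKindWArchLetterIntegrableBridge.hintArch_of_conjugator` verbatim (frames
★ arch₄ + reading frames, conjugator ★ FILE 21, presentation ★ FILE 18, engine ★ Bridge §1), conclusion re-addressed to `(ν, S', hpt)`.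
[cite: Shimura1997, §16.4, §18.4] [cite: KudlaRallis1994, §1–§2] [cite: Tan1999, §1, §3] [cite: BorelJacquet1979, §4.1] -/
theorem integrable_conj_unipDeltaChar_mul_of_archLetters (hdV0 : ∀ i, dV i ≠ 0) (hdW0 : ∀ i, dW i ≠ 0)
    {χ : HeckeCharacter L} {t : InfinitePlace L → ℤ} (ht : χ.HasUnitaryArchType t 0)
    (𝒦' : IwasawaDatum L e dV hdV dW hdW) (h𝒦' : 𝒦'.IsStd) (s₀ : ℂ)
    {A₁ : UnitaryGroup.arch (Fp L) L (IsCMField.complexConj L) (2 + 2) (hermD L e dV hdV dW hdW) → ℂ}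
    (hAlaw : ∀ p : HA L e dV hdV dW hdW, IsSiegelDelta L e dV hdV dW hdW p → UnitaryGroup.finPart (Fp L) L (IsCMField.complexConj L) (2 + 2) (hermD L e dV hdV dW hdW) p = 1 →
      ∀ x : UnitaryGroup.arch (Fp L) L (IsCMField.complexConj L) (2 + 2) (hermD L e dV hdV dW hdW),
        A₁ (UnitaryGroup.archPart (Fp L) L (IsCMField.complexConj L) (2 + 2) (hermD L e dV hdV dW hdW) p * x) = siegelDeltaCharacter L e dV hdV dW hdW χ s₀ p * A₁ x)
    (hfin : ∃ V : Submodule ℂ (UnitaryGroup.arch (Fp L) L (IsCMField.complexConj L) (2 + 2) (hermD L e dV hdV dW hdW) → ℂ), FiniteDimensional ℂ V ∧ A₁ ∈ V ∧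
      ∀ a₀ : UnitaryGroup.arch (Fp L) L (IsCMField.complexConj L) (2 + 2) (hermD L e dV hdV dW hdW),
        (UnitaryGroup.archToAdelic (Fp L) L (IsCMField.complexConj L) (2 + 2) (hermD L e dV hdV dW hdW) a₀ : HA L e dV hdV dW hdW) ∈ 𝒦'.K → ∀ G ∈ V, (fun x => G (x * a₀)) ∈ V)
    (hAc : Continuous A₁)
    (ν : Measure ↥(unipDeltaArch L e dV hdV dW hdW)) [ν.IsHaarMeasure]
    (S' : Matrix (Fin 2) (Fin 2) L) (hpt : UnitaryGroup.arch (Fp L) L (IsCMField.complexConj L) (2 + 2) (hermD L e dV hdV dW hdW)) {s : ℂ} (hs : 1 / 2 < s.re) :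
    Integrable (fun a : ↥(unipDeltaArch L e dV hdV dW hdW) =>
      conj (unipDeltaChar L e dV hdV dW hdW S'
          (UnitaryGroup.archToAdelic (Fp L) L (IsCMField.complexConj L) (2 + 2) (hermD L e dV hdV dW hdW)
            (a : UnitaryGroup.arch (Fp L) L (IsCMField.complexConj L) (2 + 2) (hermD L e dV hdV dW hdW))) : ℂ) *
        ((((modDelta L e dV hdV dW hdW (𝒦'.pPart (UnitaryGroup.archToAdelic (Fp L) L (IsCMField.complexConj L) (2 + 2) (hermD L e dV hdV dW hdW)
            (UnitaryGroup.archPart (Fp L) L (IsCMField.complexConj L) (2 + 2) (hermD L e dV hdV dW hdW) (weylDelta L e dV hdV dW hdW) *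
              (a : UnitaryGroup.arch (Fp L) L (IsCMField.complexConj L) (2 + 2) (hermD L e dV hdV dW hdW)) * hpt))) : ℝ) : ℂ) ^ (2 * (s - s₀))) *
          A₁ (UnitaryGroup.archPart (Fp L) L (IsCMField.complexConj L) (2 + 2) (hermD L e dV hdV dW hdW) (weylDelta L e dV hdV dW hdW) *
              (a : UnitaryGroup.arch (Fp L) L (IsCMField.complexConj L) (2 + 2) (hermD L e dV hdV dW hdW)) * hpt))) ν := by
  -- the tube frames of record at every complex place (★ arch₄), `choose`n once (as ★ Bridge §3)
  choose T Tinv h1 h2 hTU hTS hTiv hTN hTV hW hTdef hTinvdef using fun w : {w : InfinitePlace L // w.IsComplex} =>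
    exists_tubeFrame_arch₄ L e dV hdV dW hdW w (UnitaryGroup.complexConj_smul_infinitePlace L w.1) hdV0 hdW0
  choose B C hCu hBC using hW
  have hDC := fun w : {w : InfinitePlace L // w.IsComplex} => isUnit_det_shimuraFrame (n := 2)
    (fun k => (w.1.embedding (dV (e.symm k).1 * dW (e.symm k).2)).re)
    (tw_ne_zero L e dV hdV dW hdW w (UnitaryGroup.complexConj_smul_infinitePlace L w.1) hdV0 hdW0)
  obtain ⟨Fr, hFr⟩ : ∃ Fr : UnitaryGroup.arch (Fp L) L (IsCMField.complexConj L) (2 + 2) (hermD L e dV hdV dW hdW) → {w : InfinitePlace L // w.IsComplex} → Matrix (Fin 2 ⊕ Fin 2) (Fin 2 ⊕ Fin 2) ℂ,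
      ∀ k w, Fr k w = T w * Matrix.reindex (e₂ (n := 2)).symm (e₂ (n := 2)).symm (((UnitaryGroup.archAt (Fp L) L (IsCMField.complexConj L) (2 + 2) (hermD L e dV hdV dW hdW) w (UnitaryGroup.complexConj_smul_infinitePlace L w.1) (IsCMField.complexConj_ne_one L) k : UnitaryGroup.archLocal L (2 + 2) (hermD L e dV hdV dW hdW) w) : GL (Fin (2 + 2)) ℂ) : Matrix (Fin (2 + 2)) (Fin (2 + 2)) ℂ) * Tinv w :=
    ⟨_, fun _ _ => rfl⟩
  -- reading frames
  obtain ⟨fr, hfrM, hfrc, -⟩ := exists_readingFrame L e dV hdV dW hdW hdV0 hdW0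
  have hfrτ : ∀ w (u : Matrix.unitaryGroup (Fin 2) ℂ),
      T w * Matrix.reindex (e₂ (n := 2)).symm (e₂ (n := 2)).symm (((fr w u : UnitaryGroup.archLocal L (2 + 2) (hermD L e dV hdV dW hdW) w) : GL (Fin (2 + 2)) ℂ) :
        Matrix (Fin (2 + 2)) (Fin (2 + 2)) ℂ) * Tinv w =
      (2 : ℂ)⁻¹ • fromBlocks (1 + (u : Matrix (Fin 2) (Fin 2) ℂ)) (-(I • (1 - (u : Matrix (Fin 2) (Fin 2) ℂ)))) (I • (1 - (u : Matrix (Fin 2) (Fin 2) ℂ))) (1 + (u : Matrix (Fin 2) (Fin 2) ℂ)) := by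
    intro w u
    have hG := hfrM w u
    rw [← hTdef w, ← hTinvdef w] at hG
    rw [tube_eq_of_chart_formula (T w) (Tinv w) (h1 w) hG, kappa_eq]
  -- the conjugator of record (★ FILE 21), read in the frame
  obtain ⟨g, hg⟩ := exists_frameCompact_conjugator L e dV hdV hdV0 dW hdW hdW0 h𝒦' T Tinv hTdef hTinvdef
  have hg' : ∀ k : UnitaryGroup.arch (Fp L) L (IsCMField.complexConj L) (2 + 2) (hermD L e dV hdV dW hdW), (∀ w, moeb (Fr k w) (I • (1 : Matrix (Fin 2) (Fin 2) ℂ)) = I • 1) →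
      (UnitaryGroup.archToAdelic (Fp L) L (IsCMField.complexConj L) (2 + 2) (hermD L e dV hdV dW hdW) (g * k * g⁻¹) : HA L e dV hdV dW hdW) ∈ 𝒦'.K :=
    fun k hk => hg k fun w => by rw [← hFr]; exact hk w
  -- the (KW-fac) arch letters of `A₁` in the ★ (law)-dictionary currency
  have hA : IsArchSiegelDeltaSection L e dV hdV dW hdW χ s₀ A₁ := isArchSiegelDeltaSection_of_finPart_eq_one L e dV hdV dW hdW hAlaw
  have hK : IsArchKFinite L e dV hdV dW hdW 𝒦' A₁ := hfin
  -- ★ FILE 18: the flat tube presentation of `H(a)^{2(s−s₀)}·A₁ a` at the translated point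
  obtain ⟨m', c, Q, F, hFs, hQs, hpres⟩ := exists_flat_tube_presentation L e dV hdV hdV0 dW hdW hdW0 T Tinv Fr hFr h1 h2 hTU hTS hTV
    (fun w => diagonal fun k => (Real.sqrt (|(w.1.embedding (dV (e.symm k).1 * dW (e.symm k).2)).re| / 2) : ℂ))
    (fun w => diagonal fun k => I * ((((w.1.embedding (dV (e.symm k).1 * dW (e.symm k).2)).re / |(w.1.embedding (dV (e.symm k).1 * dW (e.symm k).2)).re|) *
      Real.sqrt (|(w.1.embedding (dV (e.symm k).1 * dW (e.symm k).2)).re| / 2) : ℝ) : ℂ))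
    hTdef (fun w => (hDC w).1) (fun w => (hDC w).2) fr hfrc hfrτ 𝒦' g hg' ht s₀ hA hK hAc
  -- the ENGINE ★ Bridge §1 at `(ν, S', hpt)` with `γ₀ := H(g⁻¹)^{2(s−s₀)}`, `G r w := ‖j(·,i1)‖^{2(s₀−s)}·F r w`, `k_w := −t_w`
  exact integrable_conj_unipDeltaChar_mul_of_sumPresentation L e dV hdV dW hdW T Tinv Fr hFr h2 hTU h1 hTiv hTN ν B C hBC (fun w => -(t w.1)) Q g hpt S' hs
    (fun r w x => (((‖(denom x (I • (1 : Matrix (Fin 2) (Fin 2) ℂ))).det‖ : ℝ) : ℂ) ^ (2 * (s₀ - s))) * F r w x) (hFs s) (hQs s)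
    ((((modDelta L e dV hdV dW hdW (𝒦'.pPart (UnitaryGroup.archToAdelic (Fp L) L (IsCMField.complexConj L) (2 + 2) (hermD L e dV hdV dW hdW) g⁻¹)) : ℝ) : ℂ) ^
      (2 * (s - s₀)))) c _ (fun a => hpres s a)

/-! ## §2 The `hintArch` letter of ★ p863805 `htail_hsplit_of_record`, verbatim -/

/-- **§2 THE `hintArch` LETTER OF ★ p863805 AT ANY INDEX, PAID FOR THE (KW-fac) ARCHIMEDEAN FACTORS OF A STANDARD DATUM.**  Inputs: `dV dW` non-zero, `χ` of unitary archimedean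
type `(t, 0)`, a standard `𝒦'`, `s₀`, the archimedean factors `A : Fin m → H_∞ → ℂ` with the three ★ (KW-fac) output clauses per `j` (★ `exists_kindW_factorization` (3), verbatim),
Haar carriers `νinf T`, and the place-indexed Σ⊗ letter's archimedean slices `Finf` with their READING `hread : Finf j s a = H_{𝒦'}(a)^{2(s−s₀)} · A j a` (`rfl` at the tie).
THEN ★ p863805's binder BYTES: for every index `S' ∈ M₂(L)` (singular included), every `h' ∈ H(𝔸)`, every finite `T`, every `s` with `1 < re s` and every `j`,
`Integrable (a ↦ conj ψ_{S'}(ι_∞ a) · Finf j s ((w_Δ)_∞ · a · h'_∞)) (νinf T)` — §1 at `(νinf T, S', h'_∞)`, `Integrable.congr` along `hread`.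
[cite: Shimura1997, §16.4, §18.4] [cite: KudlaRallis1994, §1–§2] [cite: Tan1999, §1, §3] -/
theorem hintArch_of_isArchSiegelSection (hdV0 : ∀ i, dV i ≠ 0) (hdW0 : ∀ i, dW i ≠ 0)
    {χ : HeckeCharacter L} {t : InfinitePlace L → ℤ} (ht : χ.HasUnitaryArchType t 0)
    (𝒦' : IwasawaDatum L e dV hdV dW hdW) (h𝒦' : 𝒦'.IsStd) (s₀ : ℂ) {m : ℕ}
    (A : Fin m → UnitaryGroup.arch (Fp L) L (IsCMField.complexConj L) (2 + 2) (hermD L e dV hdV dW hdW) → ℂ)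
    (hAlaw : ∀ j, ∀ p : HA L e dV hdV dW hdW, IsSiegelDelta L e dV hdV dW hdW p → UnitaryGroup.finPart (Fp L) L (IsCMField.complexConj L) (2 + 2) (hermD L e dV hdV dW hdW) p = 1 →
      ∀ x : UnitaryGroup.arch (Fp L) L (IsCMField.complexConj L) (2 + 2) (hermD L e dV hdV dW hdW),
        A j (UnitaryGroup.archPart (Fp L) L (IsCMField.complexConj L) (2 + 2) (hermD L e dV hdV dW hdW) p * x) = siegelDeltaCharacter L e dV hdV dW hdW χ s₀ p * A j x)
    (hfin : ∀ j, ∃ V : Submodule ℂ (UnitaryGroup.arch (Fp L) L (IsCMField.complexConj L) (2 + 2) (hermD L e dV hdV dW hdW) → ℂ), FiniteDimensional ℂ V ∧ A j ∈ V ∧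
      ∀ a₀ : UnitaryGroup.arch (Fp L) L (IsCMField.complexConj L) (2 + 2) (hermD L e dV hdV dW hdW),
        (UnitaryGroup.archToAdelic (Fp L) L (IsCMField.complexConj L) (2 + 2) (hermD L e dV hdV dW hdW) a₀ : HA L e dV hdV dW hdW) ∈ 𝒦'.K → ∀ G ∈ V, (fun x => G (x * a₀)) ∈ V)
    (hAc : ∀ j, Continuous (A j))
    (νinf : Finset (HeightOneSpectrum (𝓞 (Fp L))) → Measure ↥(unipDeltaArch L e dV hdV dW hdW)) [∀ T' : Finset (HeightOneSpectrum (𝓞 (Fp L))), (νinf T').IsHaarMeasure]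
    (Finf : Fin m → ℂ → UnitaryGroup.arch (Fp L) L (IsCMField.complexConj L) (2 + 2) (hermD L e dV hdV dW hdW) → ℂ)
    (hread : ∀ (j : Fin m) (s : ℂ) (a : UnitaryGroup.arch (Fp L) L (IsCMField.complexConj L) (2 + 2) (hermD L e dV hdV dW hdW)),
      Finf j s a = (((modDelta L e dV hdV dW hdW (𝒦'.pPart (UnitaryGroup.archToAdelic (Fp L) L (IsCMField.complexConj L) (2 + 2) (hermD L e dV hdV dW hdW) a)) : ℝ) : ℂ) ^
        (2 * (s - s₀))) * A j a) :
    ∀ (S' : Matrix (Fin 2) (Fin 2) L) (h' : HA L e dV hdV dW hdW) (T : Finset (HeightOneSpectrum (𝓞 (Fp L)))) (s : ℂ) (j : Fin m), 1 < s.re →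
      Integrable (fun a : ↥(unipDeltaArch L e dV hdV dW hdW) =>
        conj (unipDeltaChar L e dV hdV dW hdW S'
            (UnitaryGroup.archToAdelic (Fp L) L (IsCMField.complexConj L) (2 + 2) (hermD L e dV hdV dW hdW)
              (a : UnitaryGroup.arch (Fp L) L (IsCMField.complexConj L) (2 + 2) (hermD L e dV hdV dW hdW))) : ℂ) *
          Finf j s (UnitaryGroup.archPart (Fp L) L (IsCMField.complexConj L) (2 + 2) (hermD L e dV hdV dW hdW) (weylDelta L e dV hdV dW hdW) *
              (a : UnitaryGroup.arch (Fp L) L (IsCMField.complexConj L) (2 + 2) (hermD L e dV hdV dW hdW)) *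
              UnitaryGroup.archPart (Fp L) L (IsCMField.complexConj L) (2 + 2) (hermD L e dV hdV dW hdW) h')) (νinf T) := by
  intro S' h' T s j hs
  have hs' : 1 / 2 < s.re := by linarith
  refine (integrable_conj_unipDeltaChar_mul_of_archLetters L e dV hdV dW hdW hdV0 hdW0 ht 𝒦' h𝒦' s₀ (hAlaw j) (hfin j) (hAc j) (νinf T) S'
    (UnitaryGroup.archPart (Fp L) L (IsCMField.complexConj L) (2 + 2) (hermD L e dV hdV dW hdW) h') hs').congr (Filter.Eventually.of_forall fun a => ?_)
  beta_reduce
  rw [hread]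

end Summit.HodgeConjecture.HodgeConjecture.Cruxes.HLiu418.K2LiuKindOneArchLetterIntegrable

end
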